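import Literature.RepresentationTheory.KonnoKonno2007.RealUnitaryRankOneKAK
import HarnessLib

/-!
# `U(2,1)`: every element is `K`-conjugate to its transpose (`gᵀ = k g k⁻¹`, `k ∈ U(2) × U(1)`)

Topic `RepresentationTheory/KonnoKonno2007`; namespace `Literature.RepresentationTheory.KonnoKonno2007.RealDualPair`
(continues ★ `RealUnitaryRankOneKAK`).  KERNEL ONLY: theorems about the explicit matrices of ★ `RealUnitaryDualPair` /
★ `RealUnitaryRankOneKAK` (`UForm α β = U(α,β)`, `UForm.kV : U(α) × U(β) →* U(α,β)`, `hypV p₀ q₀ t = a_t`,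
`weylKV`); no definition, no record, no hypothesis, no `sorry`.

For the real-rank-one unitary group `U(2,1) = UForm (Fin 2) β` (`|β| = 1`) in its diagonal frame `J = diag(1,1,−1)`
the TRANSPOSE `g ↦ gᵀ` is an anti-automorphism preserving `J` (real symmetric) and `K = U(2) × U(β)`, and

  **`exists_kV_conj_eq_transpose`: for every `g ∈ U(2,1)` there is `k ∈ K` with `k g k⁻¹ = gᵀ` (as matrices).**

Proof: by ★ KAK (`exists_kV_mul_hypV_mul_kV_eq`) `g = k₁ a_t k₂`; `a_tᵀ = a_{−t}` (`coe_hypV_transpose`: `a_t` is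
hermitian with purely imaginary off-diagonal corner) `= w a_t w⁻¹` (★ `kV_weylKV_mul_hypV_mul_inv`, `w = (diag(−1,1), 1)`);
`(kV k)ᵀ = kV kᵀ` blockwise (`coe_kV_transpose`); and the **phase lemma** (`exists_phase_conj_eq_transpose`): a unitary
`u = (a b; c d) ∈ U(2)` has `|b| = |c|`, so with `ζ = −c/b` (or `ζ = 1` if `b = 0`), `|ζ| = 1` and
`diag(ζ,1) u diag(ζ,1)⁻¹ = diag(−1,1) uᵀ diag(−1,1)`; the element `m = (diag(ζ,1), ζ) ∈ K` centralises every `a_t`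
(`kV_phase_mul_hypV`), and `x := kV k₂ᵀ · w · kV m · (kV k₁)⁻¹ ∈ K` does it:
`x g x⁻¹ = kV k₂ᵀ · (w a_t w⁻¹) · (w⁻¹ (m k₂k₁ m⁻¹) w)… = kV k₂ᵀ · a_{−t} · kV k₁ᵀ = (k₁ a_t k₂)ᵀ`.

This is the geometric input («`σ g ∈ Ad(K) g`», `σ` = transpose) of Gelfand's trick for the pair
`(U(2,1) × K, ΔK)` (★ `CompactGroups/GelfandTrickOrbitalOperators`), i.e. of the multiplicity-one theorem for `K`-types
of irreducible unitary representations of `U(2,1)` (Koornwinder 1982: `(U(n,1), U(n) × U(1))` is a strong Gelfand pair;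
Kraljević 1973) and hence of Harish-Chandra's admissibility theorem [HarishChandra1953, Thms. 4–6] AT `U(2,1)`.

* `coe_kV_transpose` (public); private: `coe_hypV_transpose` (`a_tᵀ = a_{−t}`), `transpose_unitary_subsingleton` (`zᵀ = z` in
  `U(β)`, `|β| ≤ 1`), `unitaryGroup_mul_comm_of_subsingleton`, `norm_entry01_eq_norm_entry10` (`|u₀₁| = |u₁₀|` for `u ∈ U(2)`),
  `exists_phase_conj_eq_transpose` (the phase lemma), `kV_phase_mul_hypV` (`m a_t = a_t m`);
* **`exists_kV_conj_eq_transpose`** (public: `∀ g, ∃ k ∈ K, k g k⁻¹ = gᵀ`).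

## References
* [Knapp2002] A. W. Knapp, *Lie Groups Beyond an Introduction*, 2nd ed. (2002), Thm. 7.39 (`G = K A K`) — through ★ `RealUnitaryRankOneKAK`.
* [Helgason2000] S. Helgason, *Groups and Geometric Analysis*, AMS (2000), Ch. IV §3, Thm. 3.1 (Gelfand's lemma; the rôle of `σ g ∈ K g K`).
* [HarishChandra1953] Harish-Chandra, *Representations of a semisimple Lie group on a Banach space. I*, Trans. AMS 75 (1953), Thms. 4–6.

## Provenance
Cell `hodgecm-mathlib`, seat A-p14 (g27), road «T3 in-house via Gelfand's trick», FILE C.  HC_CM is proved only modulo the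
printed citations until rung 0 closes; this file is a kernel leaf about explicit matrix groups and changes no count.
-/

set_option autoImplicit false

noncomputable section

open Matrix Complex
open scoped ComplexConjugate

namespace Literature.RepresentationTheory.KonnoKonno2007

namespace RealDualPair

open Literature.NumberTheory.Automorphic

variable {α β : Type*} [Fintype α] [DecidableEq α] [Fintype β] [DecidableEq β]

/-! ## 1. Transposes of the `KAK` factors -/

/-- `(kV (u, z))ᵀ = kV (uᵀ, zᵀ)`: the block-diagonal compact element `K = U(α) × U(β)` transposes blockwise. [cite: KonnoKonno2007, §3.1] -/
theorem coe_kV_transpose (k : KV α β) :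
    ((((UForm.kV α β k : UForm α β) : GL (α ⊕ β) ℂ) : Matrix (α ⊕ β) (α ⊕ β) ℂ))ᵀ =
      (((UForm.kV α β (Matrix.UnitaryGroup.transpose k.1, Matrix.UnitaryGroup.transpose k.2) : UForm α β) :
        GL (α ⊕ β) ℂ) : Matrix (α ⊕ β) (α ⊕ β) ℂ) := by
  rw [UForm.coe_kV, UForm.coe_kV, Matrix.fromBlocks_transpose, Matrix.transpose_zero, Matrix.transpose_zero]
  rfl

variable (p₀ : α) (q₀ : β)

/-- **`a_tᵀ = a_{−t}`**: the hyperbolic one-parameter group `a_t = plant (cosh t, −i sinh t; i sinh t, cosh t)` is hermitian with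
imaginary corner, so transposition reverses it. [folklore] -/
private theorem coe_hypV_transpose (t : ℝ) :
    ((((hypV p₀ q₀ t : UForm α β) : GL (α ⊕ β) ℂ) : Matrix (α ⊕ β) (α ⊕ β) ℂ))ᵀ =
      (((hypV p₀ q₀ (-t) : UForm α β) : GL (α ⊕ β) ℂ) : Matrix (α ⊕ β) (α ⊕ β) ℂ) := by
  ext i j
  rw [Matrix.transpose_apply]
  rcases i with a | b <;> rcases j with a' | b'
  · rw [hypV_inl_inl, hypV_inl_inl, Real.cosh_neg]
    by_cases ha : a = p₀
    · subst ha
      by_cases ha' : a' = a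
      · subst ha'; simp
      · simp [ha', Ne.symm ha']
    · by_cases ha' : a' = p₀
      · subst ha'; simp [ha, Ne.symm ha]
      · simp [ha, ha', eq_comm]
  · rw [hypV_inr_inl, hypV_inl_inr, Real.sinh_neg, Complex.ofReal_neg, neg_neg]
    simp only [and_comm]
  · rw [hypV_inl_inr, hypV_inr_inl, Real.sinh_neg, Complex.ofReal_neg, neg_mul]
    simp only [and_comm]
  · rw [hypV_inr_inr, hypV_inr_inr, Real.cosh_neg]
    by_cases hb : b = q₀
    · subst hb
      by_cases hb' : b' = b
      · subst hb'; simp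
      · simp [hb', Ne.symm hb']
    · by_cases hb' : b' = q₀
      · subst hb'; simp [hb, Ne.symm hb]
      · simp [hb, hb', eq_comm]

omit [Fintype β] [DecidableEq β] in
/-- A `β × β` matrix with `|β| ≤ 1` is symmetric. [folklore] -/
private theorem transpose_eq_self_of_subsingleton [Subsingleton β] (z : Matrix β β ℂ) : zᵀ = z := by
  ext i j
  rw [Matrix.transpose_apply, Subsingleton.elim i j]

/-- In `U(β)`, `|β| ≤ 1`, transposition is the identity. [folklore] -/
private theorem transpose_unitary_subsingleton [Subsingleton β] (z : Matrix.unitaryGroup β ℂ) :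
    Matrix.UnitaryGroup.transpose z = z :=
  Subtype.ext (transpose_eq_self_of_subsingleton (z : Matrix β β ℂ))

omit [DecidableEq β] in
/-- `β × β` matrices with `|β| ≤ 1` commute. [folklore] -/
private theorem subsingleton_matrix_mul_comm [Subsingleton β] (x y : Matrix β β ℂ) : x * y = y * x := by
  ext i j
  have hj : j = i := Subsingleton.elim j i
  subst hj
  rw [Matrix.mul_apply, Matrix.mul_apply, Fintype.sum_subsingleton _ j, Fintype.sum_subsingleton _ j, mul_comm]

/-- `U(β)` is commutative for `|β| ≤ 1`. [folklore] -/
private theorem unitaryGroup_mul_comm_of_subsingleton [Subsingleton β] (x y : Matrix.unitaryGroup β ℂ) : x * y = y * x :=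
  Subtype.ext (subsingleton_matrix_mul_comm (x : Matrix β β ℂ) (y : Matrix β β ℂ))

/-! ## 2. The phase lemma in `U(2)` -/

/-- For `u ∈ U(2)` the off-diagonal entries have the same modulus, `|u₀₁| = |u₁₀|` (the `(0,0)` entries of
`u uᴴ = 1 = uᴴ u`). [folklore] -/
private theorem norm_entry01_eq_norm_entry10 (u : Matrix.unitaryGroup (Fin 2) ℂ) :
    ‖(u : Matrix (Fin 2) (Fin 2) ℂ) 0 1‖ = ‖(u : Matrix (Fin 2) (Fin 2) ℂ) 1 0‖ := by
  have h1 := congrFun (congrFun (Matrix.mem_unitaryGroup_iff.1 u.2) 0) 0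
  have h2 := congrFun (congrFun (Matrix.mem_unitaryGroup_iff'.1 u.2) 0) 0
  simp only [Matrix.mul_apply, Fin.sum_univ_two, Matrix.star_apply, Matrix.one_apply_eq, Complex.star_def,
    Complex.mul_conj', Complex.conj_mul'] at h1 h2
  -- `h1 : ‖u₀₀‖² + ‖u₀₁‖² = 1`, `h2 : ‖u₀₀‖² + ‖u₁₀‖² = 1` (in `ℂ`)
  have h : ((‖(u : Matrix (Fin 2) (Fin 2) ℂ) 0 1‖ : ℂ)) ^ 2 = ((‖(u : Matrix (Fin 2) (Fin 2) ℂ) 1 0‖ : ℂ)) ^ 2 :=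
    add_left_cancel (h1.trans h2.symm)
  have h' : ‖(u : Matrix (Fin 2) (Fin 2) ℂ) 0 1‖ ^ 2 = ‖(u : Matrix (Fin 2) (Fin 2) ℂ) 1 0‖ ^ 2 := by
    exact_mod_cast h
  exact (pow_left_inj₀ (norm_nonneg _) (norm_nonneg _) two_ne_zero).1 h'

/-- **The phase lemma.** For `u = (a b; c d) ∈ U(2)` there is a phase `ζ`, `|ζ| = 1`, with
`diag(ζ, 1) · u · diag(ζ̄, 1) = diag(−1, 1) · uᵀ · diag(−1, 1)`, i.e. `(a, ζb; ζ̄c, d) = (a, −c; −b, d)`: take `ζ = −c/b`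
(`|b| = |c|`), or `ζ = 1` when `b = c = 0`. [folklore] -/
private theorem exists_phase_conj_eq_transpose (u : Matrix.unitaryGroup (Fin 2) ℂ) :
    ∃ ζ : ℂ, ‖ζ‖ = 1 ∧
      Matrix.diagonal ![ζ, 1] * (u : Matrix (Fin 2) (Fin 2) ℂ) * Matrix.diagonal ![conj ζ, 1] =
        Matrix.diagonal ![-1, 1] * ((u : Matrix (Fin 2) (Fin 2) ℂ))ᵀ * Matrix.diagonal ![-1, 1] := by
  set U : Matrix (Fin 2) (Fin 2) ℂ := (u : Matrix (Fin 2) (Fin 2) ℂ) with hU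
  have hbc : ‖U 0 1‖ = ‖U 1 0‖ := norm_entry01_eq_norm_entry10 u
  by_cases hb : U 0 1 = 0
  · -- then `c = 0` too, and `ζ = 1` works
    have hc : U 1 0 = 0 := by
      rw [hb, norm_zero, eq_comm, norm_eq_zero] at hbc
      exact hbc
    refine ⟨1, norm_one, ?_⟩
    ext i j
    fin_cases i <;> fin_cases j <;>
      simp [Matrix.mul_apply, Matrix.diagonal, Matrix.transpose_apply, hb, hc]
  · -- `ζ = −c/b`
    have hc : U 1 0 ≠ 0 := by
      intro hc
      rw [hc, norm_zero, norm_eq_zero] at hbc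
      exact hb hbc
    set ζ : ℂ := -(U 1 0) / U 0 1 with hζdef
    -- the key scalar identities
    have hζb : ζ * U 0 1 = -(U 1 0) := by
      rw [hζdef]; field_simp
    have hbb : U 0 1 * conj (U 0 1) = U 1 0 * conj (U 1 0) := by
      rw [Complex.mul_conj', Complex.mul_conj', hbc]
    have hbconj : conj (U 0 1) ≠ 0 := by
      rwa [Ne, map_eq_zero]
    have hζc : U 1 0 * conj ζ = -(U 0 1) := by
      rw [hζdef, map_div₀, map_neg, mul_div_assoc', mul_neg, ← hbb, neg_div, mul_div_assoc, div_self hbconj, mul_one]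
    have hζζ : ζ * conj ζ = 1 := by
      rw [hζdef, map_div₀, map_neg, div_mul_div_comm, neg_mul_neg, ← hbb]
      exact div_self (mul_ne_zero hb hbconj)
    have hζn : ‖ζ‖ = 1 := by
      have h := congrArg (fun z : ℂ => ‖z‖) hζζ
      simp only [norm_mul, Complex.norm_conj, norm_one] at h
      nlinarith [norm_nonneg ζ]
    refine ⟨ζ, hζn, ?_⟩
    have h00 : ζ * U 0 0 * conj ζ = U 0 0 := by
      rw [mul_comm ζ, mul_assoc, hζζ, mul_one]
    ext i j
    fin_cases i <;> fin_cases j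
    · simpa [Matrix.mul_apply, Matrix.diagonal, Matrix.transpose_apply] using h00
    · simpa [Matrix.mul_apply, Matrix.diagonal, Matrix.transpose_apply] using hζb
    · simpa [Matrix.mul_apply, Matrix.diagonal, Matrix.transpose_apply] using hζc
    · simp [Matrix.mul_apply, Matrix.diagonal, Matrix.transpose_apply]

/-- The diagonal phase matrix `diag(ζ, 1)`, `|ζ| = 1`, is unitary. [folklore] -/
private theorem diagonal_phase_one_mem_unitaryGroup_two {ζ : ℂ} (hζ : ‖ζ‖ = 1) :
    Matrix.diagonal ![ζ, 1] ∈ Matrix.unitaryGroup (Fin 2) ℂ := by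
  rw [Matrix.mem_unitaryGroup_iff]
  ext i j
  fin_cases i <;> fin_cases j <;> simp [Matrix.mul_apply, Matrix.diagonal, Complex.mul_conj', hζ]

omit [DecidableEq β] in
/-- The scalar `ζ · 1`, `|ζ| = 1`, is unitary. [folklore] -/
private theorem phase_smul_one_mem_unitaryGroup [DecidableEq β] {ζ : ℂ} (hζ : ‖ζ‖ = 1) :
    ζ • (1 : Matrix β β ℂ) ∈ Matrix.unitaryGroup β ℂ := by
  rw [Matrix.mem_unitaryGroup_iff, star_smul, star_one, Algebra.smul_mul_assoc, one_mul, smul_smul,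
    Complex.star_def, Complex.mul_conj', hζ]
  simp

/-! ## 3. The centraliser element `m = (diag(ζ,1), ζ)` of the split torus -/

/-- **`m a_t = a_t m`** for `m = kV (D, Z)` with `D = diag(ζ, 1)`, `Z = ζ · 1`, and the split torus `a_t = hypV 0 q₀ t` of
`U(2,1)`: the matrix of `m` is diagonal with equal entries `ζ` at the two indices `inl 0`, `inr q₀` moved by `a_t`. [folklore] -/
private theorem kV_phase_mul_hypV [Subsingleton β] {ζ : ℂ} (D : Matrix.unitaryGroup (Fin 2) ℂ) (Z : Matrix.unitaryGroup β ℂ)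
    (hD : (D : Matrix (Fin 2) (Fin 2) ℂ) = Matrix.diagonal ![ζ, 1]) (hZ : (Z : Matrix β β ℂ) = ζ • (1 : Matrix β β ℂ)) (t : ℝ) :
    UForm.kV (Fin 2) β (D, Z) * hypV (0 : Fin 2) q₀ t = hypV (0 : Fin 2) q₀ t * UForm.kV (Fin 2) β (D, Z) := by
  apply Subtype.ext
  apply Units.ext
  rw [UForm.coe_mul, UForm.coe_mul, UForm.coe_kV]
  have hDZ : (Matrix.fromBlocks (D : Matrix (Fin 2) (Fin 2) ℂ) 0 0 (Z : Matrix β β ℂ) : Matrix (Fin 2 ⊕ β) (Fin 2 ⊕ β) ℂ) =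
      Matrix.diagonal (Sum.elim ![ζ, 1] fun _ => ζ) := by
    rw [hD, hZ, Matrix.smul_one_eq_diagonal, Matrix.fromBlocks_diagonal]
  change Matrix.fromBlocks (D : Matrix (Fin 2) (Fin 2) ℂ) 0 0 (Z : Matrix β β ℂ) * _ =
    _ * Matrix.fromBlocks (D : Matrix (Fin 2) (Fin 2) ℂ) 0 0 (Z : Matrix β β ℂ)
  rw [hDZ]
  ext i j
  rw [Matrix.diagonal_mul, Matrix.mul_diagonal]
  rcases i with a | b <;> rcases j with a' | b'
  · rw [hypV_inl_inl]
    simp only [Sum.elim_inl]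
    split_ifs <;> subst_vars <;> simp [mul_comm]
  · rw [hypV_inl_inr]
    simp only [Sum.elim_inl, Sum.elim_inr]
    split_ifs with h
    · obtain ⟨rfl, -⟩ := h
      simp [mul_comm]
    · simp
  · rw [hypV_inr_inl]
    simp only [Sum.elim_inl, Sum.elim_inr]
    split_ifs with h
    · obtain ⟨-, rfl⟩ := h
      simp [mul_comm]
    · simp
  · rw [hypV_inr_inr]
    simp only [Sum.elim_inr]
    exact mul_comm _ _

/-! ## 4. Every element of `U(2,1)` is `K`-conjugate to its transpose -/

/-- **`gᵀ ∈ Ad(K) g` in `U(2,1)`**: for every `g ∈ U(2,1) = UForm (Fin 2) β` (`|β| = 1`) there is `k ∈ K = U(2) × U(β)` with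
`(kV k) g (kV k)⁻¹ = gᵀ` as matrices — `KAK`, the Weyl element and the phase lemma (module docstring).  This is the hypothesis
«`σ g ∈ Ad(K) g`» of Gelfand's trick for the transpose, whence the commutativity of the `Ad K`-invariant Hecke algebra of `U(2,1)`
and multiplicity one of `K`-types (Harish-Chandra's admissibility at `U(2,1)`). [cite: HarishChandra1953, Thms. 4–6] [cite: Knapp2002, Thm. 7.39] -/
theorem exists_kV_conj_eq_transpose [Unique β] (g : UForm (Fin 2) β) :
    ∃ k : KV (Fin 2) β,
      (((UForm.kV (Fin 2) β k * g * (UForm.kV (Fin 2) β k)⁻¹ : UForm (Fin 2) β) : GL (Fin 2 ⊕ β) ℂ) :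
          Matrix (Fin 2 ⊕ β) (Fin 2 ⊕ β) ℂ) =
        ((((g : UForm (Fin 2) β) : GL (Fin 2 ⊕ β) ℂ) : Matrix (Fin 2 ⊕ β) (Fin 2 ⊕ β) ℂ))ᵀ := by
  -- `KAK` at the base indices `p₀ = 0`, `q₀ = default`
  obtain ⟨k₁, k₂, t, -, hg⟩ := exists_kV_mul_hypV_mul_kV_eq (0 : Fin 2) (default : β) g
  -- the phase lemma for `u = k₂.1 k₁.1`
  obtain ⟨ζ, hζ, hphase⟩ := exists_phase_conj_eq_transpose (k₂.1 * k₁.1)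
  rw [Submonoid.coe_mul] at hphase
  -- the centralising element `m = (D, Z)` and the transposed factors
  obtain ⟨D, hD⟩ : ∃ D : Matrix.unitaryGroup (Fin 2) ℂ, (D : Matrix (Fin 2) (Fin 2) ℂ) = Matrix.diagonal ![ζ, 1] :=
    ⟨⟨_, diagonal_phase_one_mem_unitaryGroup_two hζ⟩, rfl⟩
  obtain ⟨Z, hZ⟩ : ∃ Z : Matrix.unitaryGroup β ℂ, (Z : Matrix β β ℂ) = ζ • (1 : Matrix β β ℂ) :=
    ⟨⟨_, phase_smul_one_mem_unitaryGroup hζ⟩, rfl⟩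
  have hMA : UForm.kV (Fin 2) β (D, Z) * hypV (0 : Fin 2) (default : β) t =
      hypV (0 : Fin 2) (default : β) t * UForm.kV (Fin 2) β (D, Z) := kV_phase_mul_hypV default D Z hD hZ t
  -- the phase lemma lifted to `K`: `m (k₂k₁) m⁻¹ = w⁻¹ (k₁ᵀ k₂ᵀ) w`
  have hMK : (D, Z) * (k₂ * k₁) * (D, Z)⁻¹ =
      (weylKV (0 : Fin 2))⁻¹ * ((Matrix.UnitaryGroup.transpose k₁.1, Matrix.UnitaryGroup.transpose k₁.2) *
        (Matrix.UnitaryGroup.transpose k₂.1, Matrix.UnitaryGroup.transpose k₂.2)) * weylKV (0 : Fin 2) := by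
    refine Prod.ext ?_ ?_
    · -- the `U(2)` block: the phase lemma
      apply Subtype.ext
      simp only [weylKV, Prod.fst_mul, Prod.fst_inv, Submonoid.coe_mul, Matrix.UnitaryGroup.inv_apply,
        Matrix.UnitaryGroup.transpose_coe, hD, coe_signAt, Matrix.star_eq_conjTranspose, Matrix.diagonal_conjTranspose]
      have hs : (fun a : Fin 2 => if a = 0 then (-1 : ℂ) else 1) = ![-1, 1] := by
        funext a; fin_cases a <;> rfl
      have hsc : star ![(-1 : ℂ), 1] = ![-1, 1] := by
        funext a; fin_cases a <;> simp
      have hζc : star ![ζ, 1] = ![conj ζ, 1] := by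
        funext a; fin_cases a <;> simp
      rw [hs, hsc, hζc, hphase, Matrix.transpose_mul]
    · -- the `U(β)` block: a commutative group, and `zᵀ = z`
      simp only [weylKV, Prod.snd_mul, Prod.snd_inv, transpose_unitary_subsingleton, inv_one, one_mul, mul_one]
      rw [unitaryGroup_mul_comm_of_subsingleton Z, mul_assoc, mul_inv_cancel, mul_one, unitaryGroup_mul_comm_of_subsingleton]
  -- the conjugating element
  refine ⟨(Matrix.UnitaryGroup.transpose k₂.1, Matrix.UnitaryGroup.transpose k₂.2) * weylKV (0 : Fin 2) * (D, Z) * k₁⁻¹, ?_⟩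
  -- group-level identity: `x g x⁻¹ = kV k₂ᵀ · a_{−t} · kV k₁ᵀ`
  have key : UForm.kV (Fin 2) β ((Matrix.UnitaryGroup.transpose k₂.1, Matrix.UnitaryGroup.transpose k₂.2) *
          weylKV (0 : Fin 2) * (D, Z) * k₁⁻¹) * g *
        (UForm.kV (Fin 2) β ((Matrix.UnitaryGroup.transpose k₂.1, Matrix.UnitaryGroup.transpose k₂.2) *
          weylKV (0 : Fin 2) * (D, Z) * k₁⁻¹))⁻¹ =
      UForm.kV (Fin 2) β (Matrix.UnitaryGroup.transpose k₂.1, Matrix.UnitaryGroup.transpose k₂.2) *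
        hypV (0 : Fin 2) (default : β) (-t) *
        UForm.kV (Fin 2) β (Matrix.UnitaryGroup.transpose k₁.1, Matrix.UnitaryGroup.transpose k₁.2) := by
    -- abbreviations
    set K₁ := UForm.kV (Fin 2) β k₁ with hK₁
    set K₂ := UForm.kV (Fin 2) β k₂ with hK₂
    set A := hypV (0 : Fin 2) (default : β) t with hA
    set W := UForm.kV (Fin 2) β (weylKV (0 : Fin 2)) with hW
    set M := UForm.kV (Fin 2) β (D, Z) with hM
    set T₁ := UForm.kV (Fin 2) β (Matrix.UnitaryGroup.transpose k₁.1, Matrix.UnitaryGroup.transpose k₁.2) with hT₁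
    set T₂ := UForm.kV (Fin 2) β (Matrix.UnitaryGroup.transpose k₂.1, Matrix.UnitaryGroup.transpose k₂.2) with hT₂
    have hx : UForm.kV (Fin 2) β ((Matrix.UnitaryGroup.transpose k₂.1, Matrix.UnitaryGroup.transpose k₂.2) *
        weylKV (0 : Fin 2) * (D, Z) * k₁⁻¹) = T₂ * W * M * K₁⁻¹ := by
      rw [map_mul, map_mul, map_mul, map_inv]
    have hMK' : M * (K₂ * K₁) * M⁻¹ = W⁻¹ * (T₁ * T₂) * W := by
      rw [hM, hK₁, hK₂, hW, hT₁, hT₂, ← map_mul, ← map_mul, ← map_inv, ← map_mul, ← map_mul, ← map_inv, ← map_mul,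
        ← map_mul, hMK]
    have hWA : W * A * W⁻¹ = hypV (0 : Fin 2) (default : β) (-t) := kV_weylKV_mul_hypV_mul_inv (0 : Fin 2) default t
    rw [hx, hg, ← hWA]
    calc T₂ * W * M * K₁⁻¹ * (K₁ * A * K₂) * (T₂ * W * M * K₁⁻¹)⁻¹
        = T₂ * W * (M * A) * (K₂ * K₁) * M⁻¹ * W⁻¹ * T₂⁻¹ := by group
      _ = T₂ * W * A * (M * (K₂ * K₁) * M⁻¹) * W⁻¹ * T₂⁻¹ := by rw [hMA]; group
      _ = T₂ * (W * A * W⁻¹) * T₁ := by rw [hMK']; group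
  rw [key, UForm.coe_mul, UForm.coe_mul, hg, UForm.coe_mul, UForm.coe_mul, Matrix.transpose_mul, Matrix.transpose_mul,
    coe_kV_transpose, coe_kV_transpose, coe_hypV_transpose, Matrix.mul_assoc]

end RealDualPair

end Literature.RepresentationTheory.KonnoKonno2007

end
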